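import Literature.AnabelianGeometry.EtaleTheta.Discharge.Sec2RigidityNodesReclosedModelTate
import Literature.AnabelianGeometry.EtaleTheta.Discharge.Sec2Cor218iAtModelTateNonInnerModFour
import HarnessLib

/-!
# [EtTh] Cor 2.19 (i) (F-0626 `Cor219_i_splittings`, both splittings) AT THE STAGE-2 TATE MODEL `modelχq p i 2`
# FROM THE EXTENSION PROPERTY `hextΔ` ALONE when `p ≡ 1 (mod 4)` or `i` is even — K4 row 22 (EtTh:Cor2.19(i))
# re-keyed: the F-0620 binder of abc-iut-L2-t2's datum closer REPLACED by a structural one (proof-only)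

S. Mochizuki, *The étale theta function and its Frobenioid-theoretic manifestations* [EtTh], Publ. RIMS **45** (2009), §2:
Cor 2.19 (i) p.64 (PDF; «every automorphism of `M_η` preserves `s^alg(l·Δ_Θ)`, `s^Θ_η(l·Δ_Θ)`»), Cor 2.18 (i) p.60, Thm 1.6 (i) p.24,
Prop 2.4 p.38 («any automorphism of `Π^tp_{X̲̲}` induces automorphisms of `Π^tp_X`» — the shape of `hextΔ`)
[cite: MochizukiEtTh2009, Cor 2.19 (i) p.64; Cor 2.18 (i) p.60; Prop 2.4 p.38].

Cell abc-iut, layer L2, seat abc-iut-w6-d050 (gen 5), row «K4-RECLOSE M3» (abc-iut-L2-lead (gen 6) R788 idle-seat menu;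
abc-iut-c312-2 CONE-K4-RECLOSE v4 row 22: node EtTh:Cor2.19(i), refuted-closure binder F-0626 `RigidData.Cor219_i_splittings`).
PROOF-ONLY (0 `def`, 0 `instance`, no new `Prop`), a COMPOSITION BY NAME of
* abc-iut-f-149's `cor219_i_splittings_modelχq` — Cor 2.19 (i) at `modelχq p i j hj` for every rigidity datum
  `C.rigidData μ hC hS h15 L`, modulo ONE binder `h218i : Cor218_i` (F-0620 at the datum; temp-slimness and Prop 2.14 (i)
  being theorems there) — the closer abc-iut-L2-t2 re-keyed at the Tate datum of record (`Sec2RigidityNodesReclosedModelTate`,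
  p465271: «INSTANCE-CONDITIONAL on F-0620@datum»);
* abc-iut-L6-d6's `rigidData_cor218_i_modelχq_of_extends_of_levelChar_four` / `_of_mod_four_eq_one` / `_of_even`
  (`Sec2Cor218iAtModelTateNonInnerModFour`, p477049): F-0620 `Cor218_i` at `modelχq p i 2` with the EMPTY cusp labelling FOLLOWS
  from the extension property `hextΔ` ALONE when `χ₄ ≡ 1` on `G_{ℚ_p}` (⟸ `p ≡ 1 (mod 4)`) or `i` is even.
RESULT: **`cor219_i_splittings_modelχq_of_extends_of_mod_four_eq_one`** / `_of_levelChar_four` / `_of_even` — for every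
étale-theta datum `E` over `modelχq p i 2`, every `X̲̲`-choice `C`, level `μ`, `hC`, `hS`, `h15` and the empty labelling, BOTH
SPLITTING CLAUSES of Cor 2.19 (i) hold for EVERY automorphism of EVERY model `M_η` GIVEN ONLY `hextΔ` (every topological
automorphism of `Π^tp_{X̲̲}` extends to a `Δ^tp_X`-stabilising one of `Π^tp_X`), when `p ≡ 1 (mod 4)` (every `i`) or `i` is
even (every `p`); at the Tate datum of record `(i, j) = (1, 2)`, `E := etaleThetaDataχqInr p`:
**`cor219_i_splittings_modelTate_inr_of_extends_of_mod_four_eq_one`**, and the cone closer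
`RigidData.iso_inMu_eq_coeffAut_of_cor219` re-keyed accordingly (`iso_inMu_eq_coeffAut_modelTate_inr_of_extends_of_mod_four_eq_one`:
every automorphism of `M_η` over `γ ∈ Aut(Π^tp_{X̲̲})` acts on `μ_N` through `γ̄_μ`).  K4 READING (evidence
`K4-w6d050-COR219i-RECLOSED.tsv`): row 22's FACT binder F-0620 is REPLACED by the structural binder `hextΔ` for `p ≡ 1 (mod 4)`;
at `p ≢ 1 (mod 4)`, `i` odd it stays INSTANCE-CONDITIONAL on F-0620@datum (abc-iut-L6-d6's parity residual
`map_GtpYdd_eq_iff_levelHom_two_y_eq_zero`); the two CLOSED producers of F-0626 fire only off the data of record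
(`cor219_i_splittings_of_commutators`: `G_K = 1` Heisenberg skeleton, abc-iut-w6-d089 / f-151 `exists_rigidData_cor219_i`;
`cor219_i_splittings_of_induced_equivariance`: hypothesis = the equivariance content).
HONEST FRAMING: semi-synthetic Tate model = consistency evidence for the typed interface; `hextΔ` is a named structural hypothesis
(Prop 2.4 shape), not endorsed; F-0620 / F-0626 stay FACT-policy rows; nothing of [EtTh] (refereed) is asserted for an actual curve;
no side is taken on [IUTchIII] Cor 3.12; typed ≠ proved.
-/

noncomputable section

namespace Literature.AnabelianGeometry.EtaleTheta.SettingModel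

open Literature.AnabelianGeometry.SemiGraphs Function Topology

variable (p : ℕ) [Fact p.Prime] (i : ℤ)

/-! ## §1. `modelχq p i 2`: Cor 2.19 (i) from `hextΔ` alone (empty cusp labelling) -/

/-- **Cor 2.19 (i), both splittings, at `modelχq p i 2` FROM `hextΔ`, GIVEN `χ₄ ≡ 1` on `G_{ℚ_p}`** (f-149's `cor219_i_splittings_modelχq`
∘ L6-d6's `rigidData_cor218_i_modelχq_of_extends_of_levelChar_four`). [cite: MochizukiEtTh2009, Cor 2.19 (i) p.64] -/
theorem cor219_i_splittings_modelχq_of_extends_of_levelChar_four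
    (h4 : ∀ τ : GQp p, ZHatLevel.levelChar 4 (chi p τ) = 1)
    {E : (ThetaSetting.modelχq p i 2 even_two).EtaleThetaData} {l : ℕ} (C : E.DoubleUnderline l) {N : ℕ+}
    (μ : (ThetaSetting.modelχq p i 2 even_two).CyclotomeMod l N) (hC : (ThetaSetting.modelχq p i 2 even_two).Compat)
    (hS : (ThetaSetting.modelχq p i 2 even_two).Sec2Hyps) (h15 : ThetaSetting.Prop15iii E hC)
    (hext : ∀ γ : ↥C.Huu ≃ₜ* ↥C.Huu, ∃ Γ : PiTpχq p i 2 ≃ₜ* PiTpχq p i 2,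
      (∀ h : C.Huu, Γ (h : PiTpχq p i 2) = ((γ h : C.Huu) : PiTpχq p i 2)) ∧
        (curveχq p i 2).DeltaTemp.map Γ.toMulEquiv.toMonoidHom = (curveχq p i 2).DeltaTemp) :
    Literature.AnabelianGeometry.EtaleTheta.RigidData.Cor219_i_splittings
      (C.rigidData μ hC hS h15 ⟨fun _ => ∅, fun _ => ∅, fun _ => rfl⟩) :=
  cor219_i_splittings_modelχq p i 2 even_two C μ hC hS h15 _
    (rigidData_cor218_i_modelχq_of_extends_of_levelChar_four p i h4 C μ hC hS h15 hext)

/-- **Cor 2.19 (i), both splittings, at `modelχq p i 2` FROM `hextΔ` ALONE, for `p ≡ 1 (mod 4)`** (every `i`; in particular at the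
Tate model of record `i = 1`). [cite: MochizukiEtTh2009, Cor 2.19 (i) p.64] -/
theorem cor219_i_splittings_modelχq_of_extends_of_mod_four_eq_one (hp : p % 4 = 1)
    {E : (ThetaSetting.modelχq p i 2 even_two).EtaleThetaData} {l : ℕ} (C : E.DoubleUnderline l) {N : ℕ+}
    (μ : (ThetaSetting.modelχq p i 2 even_two).CyclotomeMod l N) (hC : (ThetaSetting.modelχq p i 2 even_two).Compat)
    (hS : (ThetaSetting.modelχq p i 2 even_two).Sec2Hyps) (h15 : ThetaSetting.Prop15iii E hC)
    (hext : ∀ γ : ↥C.Huu ≃ₜ* ↥C.Huu, ∃ Γ : PiTpχq p i 2 ≃ₜ* PiTpχq p i 2,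
      (∀ h : C.Huu, Γ (h : PiTpχq p i 2) = ((γ h : C.Huu) : PiTpχq p i 2)) ∧
        (curveχq p i 2).DeltaTemp.map Γ.toMulEquiv.toMonoidHom = (curveχq p i 2).DeltaTemp) :
    Literature.AnabelianGeometry.EtaleTheta.RigidData.Cor219_i_splittings
      (C.rigidData μ hC hS h15 ⟨fun _ => ∅, fun _ => ∅, fun _ => rfl⟩) :=
  cor219_i_splittings_modelχq p i 2 even_two C μ hC hS h15 _
    (rigidData_cor218_i_modelχq_of_extends_of_mod_four_eq_one p i hp C μ hC hS h15 hext)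

/-- **Cor 2.19 (i), both splittings, at `modelχq p i 2` FROM `hextΔ` ALONE, for EVEN `i`** (every `p`).
[cite: MochizukiEtTh2009, Cor 2.19 (i) p.64] -/
theorem cor219_i_splittings_modelχq_of_extends_of_even (hi : Even i)
    {E : (ThetaSetting.modelχq p i 2 even_two).EtaleThetaData} {l : ℕ} (C : E.DoubleUnderline l) {N : ℕ+}
    (μ : (ThetaSetting.modelχq p i 2 even_two).CyclotomeMod l N) (hC : (ThetaSetting.modelχq p i 2 even_two).Compat)
    (hS : (ThetaSetting.modelχq p i 2 even_two).Sec2Hyps) (h15 : ThetaSetting.Prop15iii E hC)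
    (hext : ∀ γ : ↥C.Huu ≃ₜ* ↥C.Huu, ∃ Γ : PiTpχq p i 2 ≃ₜ* PiTpχq p i 2,
      (∀ h : C.Huu, Γ (h : PiTpχq p i 2) = ((γ h : C.Huu) : PiTpχq p i 2)) ∧
        (curveχq p i 2).DeltaTemp.map Γ.toMulEquiv.toMonoidHom = (curveχq p i 2).DeltaTemp) :
    Literature.AnabelianGeometry.EtaleTheta.RigidData.Cor219_i_splittings
      (C.rigidData μ hC hS h15 ⟨fun _ => ∅, fun _ => ∅, fun _ => rfl⟩) :=
  cor219_i_splittings_modelχq p i 2 even_two C μ hC hS h15 _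
    (rigidData_cor218_i_modelχq_of_extends_of_even p i hi C μ hC hS h15 hext)

/-! ## §2. The Tate datum of record `(i, j) = (1, 2)`, `E := etaleThetaDataχqInr p` (abc-iut-L2-t2's shape, empty labelling) -/

variable {l : ℕ} (C : (etaleThetaDataχqInr p).DoubleUnderline l) {N : ℕ+}
  (μ : (ThetaSetting.modelχq p 1 2 even_two).CyclotomeMod l N)

/-- **F-0626 Cor 2.19 (i), both splittings, for the rigidity data of the datum OF RECORD with the EMPTY cusp labelling, from
`hextΔ` ALONE when `p ≡ 1 (mod 4)`** — abc-iut-L2-t2's `cor219_i_splittings_modelTate_inr_of_cor218_i` with its F-0620 binder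
`h218i` SUPPLIED by abc-iut-L6-d6's theorem. [cite: MochizukiEtTh2009, Cor 2.19 (i) p.64] -/
theorem cor219_i_splittings_modelTate_inr_of_extends_of_mod_four_eq_one (hp : p % 4 = 1)
    (hext : ∀ γ : ↥C.Huu ≃ₜ* ↥C.Huu, ∃ Γ : PiTpχq p 1 2 ≃ₜ* PiTpχq p 1 2,
      (∀ h : C.Huu, Γ (h : PiTpχq p 1 2) = ((γ h : C.Huu) : PiTpχq p 1 2)) ∧
        (curveχq p 1 2).DeltaTemp.map Γ.toMulEquiv.toMonoidHom = (curveχq p 1 2).DeltaTemp) :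
    Literature.AnabelianGeometry.EtaleTheta.RigidData.Cor219_i_splittings
      (C.rigidData μ (compat_modelχq p 1 2 even_two) (ThetaSetting.modelχq_sec2Hyps p 1 2 even_two)
        (prop15iii_etaleThetaDataχqInr p _) ⟨fun _ => ∅, fun _ => ∅, fun _ => rfl⟩) :=
  cor219_i_splittings_modelTate_inr_of_cor218_i p C μ _
    (rigidData_cor218_i_modelχq_of_extends_of_mod_four_eq_one p 1 hp C μ _ _ _ hext)

/-- **The cone closer `RigidData.iso_inMu_eq_coeffAut_of_cor219` at the datum of record with its F-0626 head SUPPLIED from `hextΔ`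
(`p ≡ 1 (mod 4)`, empty labelling)**: every automorphism `α` of the model mono-theta environment `M_η` lying over `γ ∈ Aut(Π^tp_{X̲̲})`
acts on `μ_N` through the coefficient automorphism `γ̄_μ` — `α(ι(a)) = ι(γ̄_μ(a))` (p.64) — with NO FACT binder left (abc-iut-L2-t2's
`iso_inMu_eq_coeffAut_modelTate_inr_of_cor218_i`, its `h218i` discharged by abc-iut-L6-d6's theorem). [cite: MochizukiEtTh2009, Cor 2.19 (i) p.64] -/
theorem iso_inMu_eq_coeffAut_modelTate_inr_of_extends_of_mod_four_eq_one (hp : p % 4 = 1)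
    (hext : ∀ γ : ↥C.Huu ≃ₜ* ↥C.Huu, ∃ Γ : PiTpχq p 1 2 ≃ₜ* PiTpχq p 1 2,
      (∀ h : C.Huu, Γ (h : PiTpχq p 1 2) = ((γ h : C.Huu) : PiTpχq p 1 2)) ∧
        (curveχq p 1 2).DeltaTemp.map Γ.toMulEquiv.toMonoidHom = (curveχq p 1 2).DeltaTemp)
    {η : (C.rigidData μ (compat_modelχq p 1 2 even_two) (ThetaSetting.modelχq_sec2Hyps p 1 2 even_two)
        (prop15iii_etaleThetaDataχqInr p _) ⟨fun _ => ∅, fun _ => ∅, fun _ => rfl⟩).PiYdd →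
      (C.rigidData μ (compat_modelχq p 1 2 even_two) (ThetaSetting.modelχq_sec2Hyps p 1 2 even_two)
        (prop15iii_etaleThetaDataχqInr p _) ⟨fun _ => ∅, fun _ => ∅, fun _ => rfl⟩).mu}
    (hη : η ∈ (C.rigidData μ (compat_modelχq p 1 2 even_two) (ThetaSetting.modelχq_sec2Hyps p 1 2 even_two)
      (prop15iii_etaleThetaDataχqInr p _) ⟨fun _ => ∅, fun _ => ∅, fun _ => rfl⟩).thetaCocycles)
    (α : ((C.rigidData μ (compat_modelχq p 1 2 even_two) (ThetaSetting.modelχq_sec2Hyps p 1 2 even_two)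
          (prop15iii_etaleThetaDataχqInr p _) ⟨fun _ => ∅, fun _ => ∅, fun _ => rfl⟩).modelMono hη).Iso
      ((C.rigidData μ (compat_modelχq p 1 2 even_two) (ThetaSetting.modelχq_sec2Hyps p 1 2 even_two)
          (prop15iii_etaleThetaDataχqInr p _) ⟨fun _ => ∅, fun _ => ∅, fun _ => rfl⟩).modelMono hη))
    (γ : (C.rigidData μ (compat_modelχq p 1 2 even_two) (ThetaSetting.modelχq_sec2Hyps p 1 2 even_two)
          (prop15iii_etaleThetaDataχqInr p _) ⟨fun _ => ∅, fun _ => ∅, fun _ => rfl⟩).PiX ≃*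
      (C.rigidData μ (compat_modelχq p 1 2 even_two) (ThetaSetting.modelχq_sec2Hyps p 1 2 even_two)
          (prop15iii_etaleThetaDataχqInr p _) ⟨fun _ => ∅, fun _ => ∅, fun _ => rfl⟩).PiX)
    (hαγ : ∀ x : (C.rigidData μ (compat_modelχq p 1 2 even_two) (ThetaSetting.modelχq_sec2Hyps p 1 2 even_two)
          (prop15iii_etaleThetaDataχqInr p _) ⟨fun _ => ∅, fun _ => ∅, fun _ => rfl⟩).env,
      ((CycEnvelope.proj
          (C.rigidData μ (compat_modelχq p 1 2 even_two) (ThetaSetting.modelχq_sec2Hyps p 1 2 even_two)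
            (prop15iii_etaleThetaDataχqInr p _) ⟨fun _ => ∅, fun _ => ∅, fun _ => rfl⟩).augY
          (C.rigidData μ (compat_modelχq p 1 2 even_two) (ThetaSetting.modelχq_sec2Hyps p 1 2 even_two)
            (prop15iii_etaleThetaDataχqInr p _) ⟨fun _ => ∅, fun _ => ∅, fun _ => rfl⟩).chi (α.e x) :
          (C.rigidData μ (compat_modelχq p 1 2 even_two) (ThetaSetting.modelχq_sec2Hyps p 1 2 even_two)
            (prop15iii_etaleThetaDataχqInr p _) ⟨fun _ => ∅, fun _ => ∅, fun _ => rfl⟩).PiY) :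
        (C.rigidData μ (compat_modelχq p 1 2 even_two) (ThetaSetting.modelχq_sec2Hyps p 1 2 even_two)
            (prop15iii_etaleThetaDataχqInr p _) ⟨fun _ => ∅, fun _ => ∅, fun _ => rfl⟩).PiX) =
      γ ((CycEnvelope.proj
          (C.rigidData μ (compat_modelχq p 1 2 even_two) (ThetaSetting.modelχq_sec2Hyps p 1 2 even_two)
            (prop15iii_etaleThetaDataχqInr p _) ⟨fun _ => ∅, fun _ => ∅, fun _ => rfl⟩).augY
          (C.rigidData μ (compat_modelχq p 1 2 even_two) (ThetaSetting.modelχq_sec2Hyps p 1 2 even_two)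
            (prop15iii_etaleThetaDataχqInr p _) ⟨fun _ => ∅, fun _ => ∅, fun _ => rfl⟩).chi x :
          (C.rigidData μ (compat_modelχq p 1 2 even_two) (ThetaSetting.modelχq_sec2Hyps p 1 2 even_two)
            (prop15iii_etaleThetaDataχqInr p _) ⟨fun _ => ∅, fun _ => ∅, fun _ => rfl⟩).PiY) :
        (C.rigidData μ (compat_modelχq p 1 2 even_two) (ThetaSetting.modelχq_sec2Hyps p 1 2 even_two)
            (prop15iii_etaleThetaDataχqInr p _) ⟨fun _ => ∅, fun _ => ∅, fun _ => rfl⟩).PiX))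
    (γμ : (C.rigidData μ (compat_modelχq p 1 2 even_two) (ThetaSetting.modelχq_sec2Hyps p 1 2 even_two)
          (prop15iii_etaleThetaDataχqInr p _) ⟨fun _ => ∅, fun _ => ∅, fun _ => rfl⟩).mu ≃*
      (C.rigidData μ (compat_modelχq p 1 2 even_two) (ThetaSetting.modelχq_sec2Hyps p 1 2 even_two)
          (prop15iii_etaleThetaDataχqInr p _) ⟨fun _ => ∅, fun _ => ∅, fun _ => rfl⟩).mu)
    (hγμ : ∀ (g : (C.rigidData μ (compat_modelχq p 1 2 even_two) (ThetaSetting.modelχq_sec2Hyps p 1 2 even_two)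
            (prop15iii_etaleThetaDataχqInr p _) ⟨fun _ => ∅, fun _ => ∅, fun _ => rfl⟩).lDeltaTheta)
        (hg' : γ g ∈ (C.rigidData μ (compat_modelχq p 1 2 even_two) (ThetaSetting.modelχq_sec2Hyps p 1 2 even_two)
            (prop15iii_etaleThetaDataχqInr p _) ⟨fun _ => ∅, fun _ => ∅, fun _ => rfl⟩).lDeltaTheta),
      (C.rigidData μ (compat_modelχq p 1 2 even_two) (ThetaSetting.modelχq_sec2Hyps p 1 2 even_two)
          (prop15iii_etaleThetaDataχqInr p _) ⟨fun _ => ∅, fun _ => ∅, fun _ => rfl⟩).thetaMod ⟨γ g, hg'⟩ =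
        γμ ((C.rigidData μ (compat_modelχq p 1 2 even_two) (ThetaSetting.modelχq_sec2Hyps p 1 2 even_two)
          (prop15iii_etaleThetaDataχqInr p _) ⟨fun _ => ∅, fun _ => ∅, fun _ => rfl⟩).thetaMod g))
    (a : (C.rigidData μ (compat_modelχq p 1 2 even_two) (ThetaSetting.modelχq_sec2Hyps p 1 2 even_two)
        (prop15iii_etaleThetaDataχqInr p _) ⟨fun _ => ∅, fun _ => ∅, fun _ => rfl⟩).mu) :
    α.e (CycEnvelope.inMu
        (C.rigidData μ (compat_modelχq p 1 2 even_two) (ThetaSetting.modelχq_sec2Hyps p 1 2 even_two)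
          (prop15iii_etaleThetaDataχqInr p _) ⟨fun _ => ∅, fun _ => ∅, fun _ => rfl⟩).augY
        (C.rigidData μ (compat_modelχq p 1 2 even_two) (ThetaSetting.modelχq_sec2Hyps p 1 2 even_two)
          (prop15iii_etaleThetaDataχqInr p _) ⟨fun _ => ∅, fun _ => ∅, fun _ => rfl⟩).chi a) =
      CycEnvelope.inMu
        (C.rigidData μ (compat_modelχq p 1 2 even_two) (ThetaSetting.modelχq_sec2Hyps p 1 2 even_two)
          (prop15iii_etaleThetaDataχqInr p _) ⟨fun _ => ∅, fun _ => ∅, fun _ => rfl⟩).augY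
        (C.rigidData μ (compat_modelχq p 1 2 even_two) (ThetaSetting.modelχq_sec2Hyps p 1 2 even_two)
          (prop15iii_etaleThetaDataχqInr p _) ⟨fun _ => ∅, fun _ => ∅, fun _ => rfl⟩).chi (γμ a) :=
  Literature.AnabelianGeometry.EtaleTheta.RigidData.iso_inMu_eq_coeffAut_of_cor219
    (cor219_i_splittings_modelTate_inr_of_extends_of_mod_four_eq_one p C μ hp hext) hη α γ hαγ γμ hγμ a

end Literature.AnabelianGeometry.EtaleTheta.SettingModel

end
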